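import Literature.LinearAlgebra.Matrix.FiniteRangeDecompositionMatrix
import HarnessLib

/-!
# The finite-range decomposition of a positive quadratic form on a finite set, III:
# an explicit antitone majorant of the scale functions `g_j`
# (BBS Ch. 3, the `P_t`-lemma `|P_t(ζ)| ≤ c_s(1+t²ζ)^{-s}`, integrated over one scale)

Companion of `FiniteRangeDecompositionMatrix.lean` (`MatrixFRD.wFun/gFun/piece`).  The kernel and
increment bounds of the pieces `C_j = g_j(Q)` on a torus
(`Literature/Probability/LatticeModels/TorusFormFiniteRangeDecomposition.lean`,
`…/TorusFormCharacterExpansion.lean`) are momentum sums of ANY antitone majorant `G ≥ g_j` on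
`[0,∞)`; this file supplies the canonical one.  From the two cases of BBS's `P_t`-lemma
(`FRD.chebyProfile_profile_eq_of_lt_one`: `P_t = f̂(0)/(2πt)` for `t < 1`;
`FRD.abs_chebyProfile_profile_le`: `|P_t(ζ)| ≤ c₃(1+t²ζ)^{-3}` for `t ≥ 1`, `ζ ∈ [0,4]`) and the
observation that `P_t(ζ) = P_t(4)` for `ζ ≥ 4` (`arccos` saturates), for `Θ > 0`, `L_* ≥ 2`, `j ≥ 1`,
`μ ≥ 0`:

  `g_j(μ) ≤ (K/Θ) · ( 𝟙[j = 1] + (L_*^j/2)² · (1 + (L_*^{j-1}/2)²·min(μ,4Θ)/Θ)^{-3} )`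

with ONE constant `K` depending only on the profile (`exists_gFun_le_majorant`), and the right side is
antitone in `μ ∈ [0,∞)` (`antitoneOn_gMajorant`).  (Heuristically `g_j(μ) ≈ ∫_{L^{j-1}/2}^{L^j/2} t e^{-t²μ}dt/Θ`:
of size `L^{2j}/Θ` for `μ ≲ L^{-2j}Θ` and rapidly small beyond — the majorant keeps the cube of the
natural decay, enough for `d ≤ 5`.)

## Contents (no new definition besides the abbreviation-free statements)

* `chebyProfile_eq_of_four_le`, `wFun_eq_wFun_min`, `gFun_eq_gFun_min` — saturation beyond `ζ = 4`;
* `wFun_div_le_of_lt_one`, `wFun_div_le_of_one_le` — the two pointwise regimes;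
* **`exists_gFun_le_majorant`**, **`antitoneOn_gMajorant`**, `gMajorant_nonneg`.

## References

* R. Bauerschmidt, D. C. Brydges, G. Slade, LNM 2242 (2019), Ch. 3, the `P_t`-lemma and
  Proposition "Covariance decomposition" (3.11). [BauerschmidtBrydgesSlade2019RG]
* R. Bauerschmidt, PTRF 157 (2013), Thm. 1.2 (bounds on the pieces). [Bauerschmidt2013]
-/

noncomputable section

open MeasureTheory Set
open scoped Real FourierTransform
open Literature.Barriers.CriticalPhenomena.LongRangePhi4

namespace Literature.LinearAlgebra.Matrix

namespace MatrixFRD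

/-! ### Saturation of the profile beyond `ζ = 4` -/

/-- `P_t(ζ) = P_t(4)` for `ζ ≥ 4` (`arccos(1 - ζ/2) = π` there). [folklore] -/
theorem chebyProfile_eq_of_four_le (f : ℝ → ℝ) (t : ℝ) {ζ : ℝ} (hζ : 4 ≤ ζ) :
    FRD.chebyProfile f t ζ = FRD.chebyProfile f t 4 := by
  unfold FRD.chebyProfile
  rw [Real.arccos_of_le_neg_one (by linarith), show (1 : ℝ) - 4 / 2 = -1 by norm_num,
    Real.arccos_neg_one]

/-- The kernel only sees `min(μ, 4Θ)`: `ŵ_Θ(t,μ) = ŵ_Θ(t, min(μ,4Θ))` (`Θ > 0`). [folklore] -/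
theorem wFun_eq_wFun_min {Θ : ℝ} (hΘ : 0 < Θ) (t μ : ℝ) :
    wFun Θ t μ = wFun Θ t (min μ (4 * Θ)) := by
  unfold wFun
  rcases le_total μ (4 * Θ) with h | h
  · rw [min_eq_left h]
  · rw [min_eq_right h, chebyProfile_eq_of_four_le _ _ ((le_div_iff₀ hΘ).mpr (by linarith)),
      show 4 * Θ / Θ = 4 by field_simp]

/-- `g_j(μ) = g_j(min(μ,4Θ))`. [folklore] -/
theorem gFun_eq_gFun_min {Θ : ℝ} (hΘ : 0 < Θ) (L : ℝ) (j : ℕ) (μ : ℝ) :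
    gFun Θ L j μ = gFun Θ L j (min μ (4 * Θ)) := by
  unfold gFun
  simp_rw [wFun_eq_wFun_min hΘ _ μ]

/-! ### The two pointwise regimes -/

/-- Small scales: for `0 < t < 1`, `ŵ_Θ(t,μ)/t = Re f̂(0)/(2π c Θ)`, hence
`≤ |Re f̂(0)|/(2π c)/Θ`. [cite: BauerschmidtBrydgesSlade2019RG, Ch. 3, the P_t-lemma (case t < 1)] -/
theorem wFun_div_le_of_lt_one {Θ : ℝ} (hΘ : 0 < Θ) {t : ℝ} (ht0 : 0 < t) (ht1 : t < 1) (μ : ℝ) :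
    wFun Θ t μ / t ≤ |(𝓕 (FRD.profile : ℝ → ℂ) 0).re| / (2 * π * FRD.cProfile) / Θ := by
  have hc := FRD.cProfile_pos
  unfold wFun
  rw [FRD.chebyProfile_profile_eq_of_lt_one ht0 ht1]
  have : t ^ 2 / (FRD.cProfile * Θ) * ((2 * π * t)⁻¹ * (𝓕 (FRD.profile : ℝ → ℂ) 0).re) / t =
      (𝓕 (FRD.profile : ℝ → ℂ) 0).re / (2 * π * FRD.cProfile) / Θ := by
    field_simp
  rw [this]
  gcongr
  exact le_abs_self _

/-- Large scales: for `t ≥ 1` and `μ ≥ 0`, with the constant `c₃` of the `P_t`-lemma (`s = 3`),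
`ŵ_Θ(t,μ)/t ≤ (c₃/c) · t · (1 + t²·min(μ,4Θ)/Θ)^{-3} / Θ`.
[cite: BauerschmidtBrydgesSlade2019RG, Ch. 3, the P_t-lemma (case t ≥ 1)] -/
theorem wFun_div_le_of_one_le {c₃ : ℝ}
    (hc₃ : ∀ t : ℝ, 1 ≤ t → ∀ ζ ∈ Icc (0:ℝ) 4,
      |FRD.chebyProfile (fun v => (FRD.profile v).re) t ζ| ≤ c₃ * ((1 + t ^ 2 * ζ) ^ 3)⁻¹)
    {Θ : ℝ} (hΘ : 0 < Θ) {t : ℝ} (ht : 1 ≤ t) {μ : ℝ} (hμ : 0 ≤ μ) :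
    wFun Θ t μ / t ≤ c₃ / FRD.cProfile * (t * ((1 + t ^ 2 * (min μ (4 * Θ) / Θ)) ^ 3)⁻¹) / Θ := by
  have hc := FRD.cProfile_pos
  have ht0 : 0 < t := by linarith
  rw [wFun_eq_wFun_min hΘ]
  set m := min μ (4 * Θ) with hm
  have hm0 : 0 ≤ m := le_min hμ (by linarith)
  have hm4 : m / Θ ∈ Icc (0:ℝ) 4 :=
    ⟨div_nonneg hm0 hΘ.le, by rw [div_le_iff₀ hΘ]; exact min_le_right _ _⟩
  have key := (le_abs_self _).trans (hc₃ t ht (m / Θ) hm4)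
  unfold wFun
  have hrew : t ^ 2 / (FRD.cProfile * Θ) * FRD.chebyProfile (fun v => (FRD.profile v).re) t (m / Θ) / t
      = (t / (FRD.cProfile * Θ)) * FRD.chebyProfile (fun v => (FRD.profile v).re) t (m / Θ) := by
    field_simp
  rw [hrew]
  calc t / (FRD.cProfile * Θ) * FRD.chebyProfile (fun v => (FRD.profile v).re) t (m / Θ)
      ≤ t / (FRD.cProfile * Θ) * (c₃ * ((1 + t ^ 2 * (m / Θ)) ^ 3)⁻¹) :=
        mul_le_mul_of_nonneg_left key (by positivity)
    _ = c₃ / FRD.cProfile * (t * ((1 + t ^ 2 * (m / Θ)) ^ 3)⁻¹) / Θ := by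
        field_simp

/-! ### The majorant -/

/-- **The canonical antitone majorant of the scale functions.**  There is `K > 0` (depending only on
the profile) such that for all `Θ > 0`, `L_* ≥ 2`, `j ≥ 1`, `μ ≥ 0`:
`g_j(μ) ≤ (K/Θ)·(𝟙[j=1] + (L_*^j/2)²·(1 + (L_*^{j-1}/2)²·min(μ,4Θ)/Θ)^{-3})`.
[cite: BauerschmidtBrydgesSlade2019RG, Ch. 3, Proposition "Covariance decomposition", proof of (3.11) (integration of the w-bound over one scale)] -/
theorem exists_gFun_le_majorant :
    ∃ K : ℝ, 0 < K ∧ ∀ Θ : ℝ, 0 < Θ → ∀ L : ℝ, 2 ≤ L → ∀ j : ℕ, 1 ≤ j → ∀ μ : ℝ, 0 ≤ μ →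
      gFun Θ L j μ ≤ K / Θ * ((if j = 1 then (1:ℝ) else 0) +
        (L ^ j / 2) ^ 2 * ((1 + (L ^ (j - 1) / 2) ^ 2 * (min μ (4 * Θ) / Θ)) ^ 3)⁻¹) := by
  obtain ⟨c₃, hc₃pos, hc₃⟩ := FRD.abs_chebyProfile_profile_le (s := 3) (by norm_num)
  have hc := FRD.cProfile_pos
  set α : ℝ := |(𝓕 (FRD.profile : ℝ → ℂ) 0).re| / (2 * π * FRD.cProfile) with hα
  have hα0 : 0 ≤ α := by positivity
  refine ⟨α + c₃ / FRD.cProfile, by positivity, fun Θ hΘ L hL j hj μ hμ => ?_⟩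
  set K : ℝ := α + c₃ / FRD.cProfile with hK
  have hK1 : α ≤ K := by simp [hK]; positivity
  have hK2 : c₃ / FRD.cProfile ≤ K := by simp [hK, hα0]
  set m := min μ (4 * Θ) with hm
  have hm0 : 0 ≤ m := le_min hμ (by linarith)
  set a : ℝ := L ^ (j - 1) / 2 with ha
  set b : ℝ := L ^ j / 2 with hb
  set q : ℝ := ((1 + a ^ 2 * (m / Θ)) ^ 3)⁻¹ with hq
  have hL0 : 0 ≤ L := by linarith
  have ha0 : 0 < a := by positivity
  have hb1 : 1 ≤ b := by
    rw [hb, le_div_iff₀ (by norm_num : (0:ℝ) < 2)]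
    calc (1 : ℝ) * 2 = 2 ^ 1 := by norm_num
      _ ≤ 2 ^ j := pow_le_pow_right₀ (by norm_num) hj
      _ ≤ L ^ j := pow_le_pow_left₀ (by norm_num) hL j
  have hab : a ≤ b := by
    rw [ha, hb]
    gcongr
    · linarith
    · omega
  have hq0 : 0 ≤ q := by positivity
  have hsb : scaleEnd L j = b := scaleEnd_of_ne_zero L (by omega)
  set s₀ : ℝ := scaleEnd L (j - 1) with hs₀
  have hs₀0 : 0 ≤ s₀ := scaleEnd_nonneg hL0 _
  have hs₀a : j ≠ 1 → s₀ = a := fun hj1 => by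
    rw [hs₀, scaleEnd_of_ne_zero L (by omega), ha]
  -- (1) the pointwise bound on the scale interval
  have hpt : ∀ t ∈ Ioc s₀ b, wFun Θ t μ / t ≤
      K / Θ * (Set.indicator (Iio (1:ℝ)) (fun _ => (1:ℝ)) t + b * q) := by
    intro t ht
    have ht0 : 0 < t := hs₀0.trans_lt ht.1
    by_cases h1 : t < 1
    · rw [Set.indicator_of_mem (show t ∈ Iio (1:ℝ) from h1)]
      calc wFun Θ t μ / t ≤ α / Θ := wFun_div_le_of_lt_one hΘ ht0 h1 μ
        _ ≤ K / Θ * (1 + b * q) := by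
            rw [div_eq_mul_inv, div_eq_mul_inv]
            have : α * Θ⁻¹ ≤ K * Θ⁻¹ := mul_le_mul_of_nonneg_right hK1 (by positivity)
            refine this.trans ?_
            have h1bq : (1:ℝ) ≤ 1 + b * q := by nlinarith [mul_nonneg (by linarith : (0:ℝ) ≤ b) hq0]
            calc K * Θ⁻¹ = K * Θ⁻¹ * 1 := by ring
              _ ≤ K * Θ⁻¹ * (1 + b * q) := mul_le_mul_of_nonneg_left h1bq (by positivity)
    · have ht1 : 1 ≤ t := not_lt.mp h1
      rw [Set.indicator_of_notMem (show t ∉ Iio (1:ℝ) from h1), zero_add]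
      have hat : a ≤ t := by
        by_cases hj1 : j = 1
        · subst hj1
          have : a = 1 / 2 := by rw [ha]; norm_num
          linarith
        · rw [← hs₀a hj1]; exact ht.1.le
      calc wFun Θ t μ / t ≤ c₃ / FRD.cProfile * (t * ((1 + t ^ 2 * (min μ (4 * Θ) / Θ)) ^ 3)⁻¹) / Θ :=
            wFun_div_le_of_one_le hc₃ hΘ ht1 hμ
        _ ≤ K * (b * q) / Θ := by
            rw [← hm]
            have hqt : ((1 + t ^ 2 * (m / Θ)) ^ 3)⁻¹ ≤ q := by
              rw [hq]
              apply inv_anti₀ (by positivity)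
              gcongr
            have htq : t * ((1 + t ^ 2 * (m / Θ)) ^ 3)⁻¹ ≤ b * q :=
              mul_le_mul ht.2 hqt (by positivity) (by linarith)
            have := mul_le_mul hK2 htq (by positivity) (by positivity)
            exact div_le_div_of_nonneg_right this hΘ.le
        _ = K / Θ * (b * q) := by ring
  -- (2) integrate
  have hmeas : MeasurableSet (Ioc s₀ b) := measurableSet_Ioc
  have hfin : volume (Ioc s₀ b) ≠ ⊤ := by simp
  have hIf : IntegrableOn (fun t => wFun Θ t μ / t) (Ioc s₀ b) := by
    have h := integrableOn_wFun_div_Ioc hΘ hm0 (min_le_right μ (4 * Θ)) hs₀0 b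
    refine h.congr_fun (fun t _ => ?_) measurableSet_Ioc
    exact (congrArg (· / t) (wFun_eq_wFun_min hΘ t μ)).symm
  have hIg : IntegrableOn (fun t => K / Θ * (Set.indicator (Iio (1:ℝ)) (fun _ => (1:ℝ)) t + b * q))
      (Ioc s₀ b) := by
    refine Integrable.const_mul (Integrable.add ?_ (integrableOn_const (by simp))) _
    exact (integrableOn_const (by simp)).indicator measurableSet_Iio
  have hmono := setIntegral_mono_on hIf hIg hmeas hpt
  unfold gFun
  rw [hsb]
  refine hmono.trans ?_
  rw [integral_const_mul]
  refine mul_le_mul_of_nonneg_left ?_ (by positivity)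
  have hI1 : IntegrableOn (fun t => Set.indicator (Iio (1:ℝ)) (fun _ => (1:ℝ)) t) (Ioc s₀ b) :=
    (integrableOn_const (by simp)).indicator measurableSet_Iio
  have hI2 : IntegrableOn (fun _ : ℝ => b * q) (Ioc s₀ b) := integrableOn_const (by simp)
  rw [integral_add hI1 hI2, setIntegral_const, smul_eq_mul]
  -- the indicator part: `vol((s₀,b] ∩ (-∞,1)) ≤ 𝟙[j = 1]`
  have hind : ∫ t in Ioc s₀ b, Set.indicator (Iio (1:ℝ)) (fun _ => (1:ℝ)) t ≤
      (if j = 1 then (1:ℝ) else 0) := by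
    rw [setIntegral_indicator measurableSet_Iio, setIntegral_const, smul_eq_mul, mul_one,
      measureReal_def]
    by_cases hj1 : j = 1
    · rw [if_pos hj1]
      have hsub : Ioc s₀ b ∩ Iio 1 ⊆ Ioc s₀ (max s₀ 1) := by
        intro t ht
        exact ⟨ht.1.1, le_max_of_le_right (le_of_lt ht.2)⟩
      calc (volume (Ioc s₀ b ∩ Iio 1)).toReal ≤ (volume (Ioc s₀ (max s₀ 1))).toReal := by
            exact ENNReal.toReal_mono (by simp) (measure_mono hsub)
        _ ≤ 1 := by
            rw [Real.volume_Ioc, ENNReal.toReal_ofReal (by simp)]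
            rcases le_total s₀ 1 with h | h
            · rw [max_eq_right h]; linarith
            · rw [max_eq_left h]; linarith
    · rw [if_neg hj1]
      have ha1 : 1 ≤ a := by
        rw [ha, le_div_iff₀ (by norm_num : (0:ℝ) < 2)]
        have hj2 : 1 ≤ j - 1 := by omega
        calc (1:ℝ) * 2 = 2 ^ 1 := by norm_num
          _ ≤ 2 ^ (j - 1) := pow_le_pow_right₀ (by norm_num) hj2
          _ ≤ L ^ (j - 1) := pow_le_pow_left₀ (by norm_num) hL _
      have hempty : Ioc s₀ b ∩ Iio 1 = ∅ := by
        ext t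
        simp only [Set.mem_inter_iff, Set.mem_Ioc, Set.mem_Iio, Set.mem_empty_iff_false, iff_false,
          not_and, not_lt, and_imp]
        intro h1 _
        rw [hs₀a hj1] at h1
        linarith
      rw [hempty, measure_empty, ENNReal.toReal_zero]
  -- the constant part: `vol · b q ≤ b² q`
  have hconst : volume.real (Ioc s₀ b) * (b * q) ≤ b ^ 2 * q := by
    rw [measureReal_def]
    by_cases hle : s₀ ≤ b
    · rw [Real.volume_Ioc, ENNReal.toReal_ofReal (by linarith)]
      have : (b - s₀) * (b * q) ≤ b * (b * q) :=
        mul_le_mul_of_nonneg_right (by linarith) (by positivity)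
      nlinarith
    · push Not at hle
      rw [Ioc_eq_empty (by linarith), measure_empty, ENNReal.toReal_zero, zero_mul]
      positivity
  have hb2 : (L ^ j / 2) ^ 2 = b ^ 2 := by rw [hb]
  rw [hb2]
  exact add_le_add hind hconst

/-- The majorant is nonnegative. [folklore] -/
theorem gMajorant_nonneg {K Θ L : ℝ} (hK : 0 ≤ K) (hΘ : 0 < Θ) (j : ℕ) {μ : ℝ} (hμ : 0 ≤ μ) :
    0 ≤ K / Θ * ((if j = 1 then (1:ℝ) else 0) +
      (L ^ j / 2) ^ 2 * ((1 + (L ^ (j - 1) / 2) ^ 2 * (min μ (4 * Θ) / Θ)) ^ 3)⁻¹) := by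
  have hm0 : 0 ≤ min μ (4 * Θ) := le_min hμ (by linarith)
  have : 0 ≤ (if j = 1 then (1:ℝ) else 0) := by split_ifs <;> norm_num
  positivity

/-- **The majorant is antitone in `μ ∈ [0,∞)`** (`min` is monotone and `x ↦ (1 + cx)^{-3}` is
antitone for `c ≥ 0`). [folklore] -/
theorem antitoneOn_gMajorant {K Θ L : ℝ} (hK : 0 ≤ K) (hΘ : 0 < Θ) (j : ℕ) :
    AntitoneOn (fun μ : ℝ => K / Θ * ((if j = 1 then (1:ℝ) else 0) +
      (L ^ j / 2) ^ 2 * ((1 + (L ^ (j - 1) / 2) ^ 2 * (min μ (4 * Θ) / Θ)) ^ 3)⁻¹)) (Set.Ici 0) := by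
  intro μ hμ ν hν hμν
  have hμ0 : 0 ≤ μ := hμ
  have hmin : min μ (4 * Θ) ≤ min ν (4 * Θ) := min_le_min_right _ hμν
  have hm0 : 0 ≤ min μ (4 * Θ) := le_min hμ0 (by linarith)
  dsimp only
  refine mul_le_mul_of_nonneg_left (add_le_add le_rfl ?_) (by positivity)
  refine mul_le_mul_of_nonneg_left ?_ (by positivity)
  apply inv_anti₀ (by positivity)
  gcongr

end MatrixFRD

end Literature.LinearAlgebra.Matrix

end
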